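import Summits.QuantumFields.YangMills.Theses.BalabanUVNodes
import Summits.QuantumFields.YangMills.Theorems.BalabanUVNodesN27AtRecord13CoPHKeyedCore
import Summits.QuantumFields.YangMills.Theorems.BalabanUVNodesN21DilationRoadAtReadingOfRecord13CoPH

/-!
# BalabanUVNodes ∕ N27 = binder B5 AT dag-n20-d's READING OF RECORD, leaf F — K3⁷ `Theses.BalabanUVNodes.SpineGivenEndpointR13SepCoPH` FROM THE KEYED FACES AT
# `cr := YMDAG.UVSplit.crOfRecord₁₃At K₀ jcut sh` WITH THE N21 FACE SUPPLIED BY THE DILATION ROAD (no domination clause): leaf E (p585601)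
# `spineGivenEndpointR13SepCoPH_of_keyedFacesP_dilationLevels` instantiated at the reading, `h21` := file 5's `shellWeightBound_guarded_crOfRecord₁₃At_of_dilationLevels`

Track A of `YM-PLAN.md` (cell `pub-ymgap`, HUMAN RULING D-0062 ∕ D-0149 width seats), node **N21** feeding binder B5 = **N27**; WIDTH SEAT `pub-ymgap-dag-n21-w2` (gen 0),
W-SEAT-START-LIST v4 §n21 ITEM 2, file 6 = the TERMINAL route-facing companion of file 5 `…N21DilationRoadAtReadingOfRecord13CoPH` (split off so that file 5 stays outside
the theses cone — gate `lint.theses-cone`; nothing may import this file).  THEOREMS ONLY: 0 `def`, 0 `sorry`, standard axioms; COUNT-NEUTRAL; `--kind proof --supports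
stmt-QuantumFields-20544 --as helper`.  Imports the Theses file (the item BY NAME), n27-c's `N`-generic guarded composer `…N27AtRecord13CoPHKeyedCore` and file 5.  Leaf D ∕ E are
NOT imported (their one-line move is repeated: `fun F θ hP hG hθ _ _ ↦ …` — the two discarded antecedents `_ _` are (B) and END, which recur inside the `HybridNE7Under`
conclusion; ref-O READ-11∕70 NIT).  Restates nothing; cites by name.  (v1.2: docstring-only edition — this note, the «superseded pointer» mark on the v1.0 theorem; decls unchanged.)

WHAT IS KERNEL-CHECKED ([bookkeeping]; `N = 2`; rates reading `rr` and rates predicate `P` PARAMETERS as in leaf A §2 ∕ leaf D ∕ leaf E).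
* ★★ `spineGivenEndpointR13SepCoPH_crOfRecord₁₃At_of_keyedFacesP_dilationLevels` — THE ITEM from N20 AT THE READING, the dilation ∃-package at the reading's carriers
  `(1, classSet₁₃ θ K₀ g₀, weightA₁₃ …, weightB₁₃ …, (sh …).1, (sh …).2)` IN PLACE OF `h21` (NO domination ∕ summability clause on the weight slot — the canonical `wshInf`
  absorbs it), the rates at `P`, the N19′ edge reading `P` and the keyed extraction clause AT THE READING (n27-c `keyedGuarded₁₃CoPH_of_keyedFacesP` BY NAME).  dag-n20-d's
  `keyedExtraction_crOfRecord₁₃At` ∕ `relWeightBound_crOfRecord₁₃At` ∕ `core_crOfRecord₁₃At` and dag-n20-w1's sockets turn `hx` ∕ `h20` ∕ `h19` into term-level statements;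
  they are NOT consumed here (other pens' composers).

* (v1.1, APPEND-ONLY) ★★ `spineGivenEndpointR13SepCoPH_crOfRecord₁₃VAt_of_keyedFacesP_dilationLevels` — the same AT dag-n20-d's V EDITION `crOfRecord₁₃VAt K₀ jcut sh`
  (`vol := F.side ^ 4`; the K3⁷ v3 pointer of record), `h21` := file 5 v1.1's `shellWeightBound_guarded_crOfRecord₁₃VAt_of_dilationLevels`.

HONEST FRAMING.  NOT a discharge: a term of the item's type under displayed hypotheses (audit `proof.conditional`), every one inhabited for no family today (K0⁷ OPEN); the
dilation package a HYPOTHESIS per tuple; `sh` (shell split) and `jcut` (persistence policy) are dag-n20-d's DISPLAYED letters, NOT inhabited; NE3 ∕ NE7 ∕ NE7b ∕ NE7c NOT PROVED;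
nothing of Bałaban's asserted; N21 NOT discharged, N27 COMPOSITE NOT discharged; K3⁷ NOT claimed closed; route rev 25 and the skeleton of record UNTOUCHED (additive file);
counts UNMOVED (typed 28∕28 · discharged 5∕27); one finite four-torus programme at fixed `ε` — NOT ℝ⁴, NOT infinite volume, NOT OS, NOT a mass gap, NOT Clay.  No decl below
carries a cite tag.
-/

set_option autoImplicit false

open Finset

namespace Summit.QuantumFields.YangMills.Theorems.N21DilationRoadAtRecord13CoPH

open Literature.MathematicalPhysics.QuantumFieldTheory.Balaban1983to89
open Literature.MathematicalPhysics.QuantumFieldTheory.Balaban1983to89.T4Continuum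
open Literature.MathematicalPhysics.QuantumFieldTheory.Balaban1983to89.Node00
open T4WeightBudget (RelWeightBound)
open T4IndicatorShell (ShellWeightBound)
open T4ShellMeasureLevels (LevelLedger LiveWindow)
open T4ContinuumYM4Torus (ForSmallCouplings)
open Summit.QuantumFields.BalabanUV.T4Continuum.Spine
open Summit.QuantumFields.YangMills.Theses.BalabanUVNodes (SpineGivenEndpointR13SepCoPH)
open YMDAG.UVSplit

section LeafF

open BalabanUVNodesN27SpineRecord (keyedGuarded₁₃CoPH_of_keyedFacesP)

variable (K₀ : ℕ) (jcut : ℕ → ℕ) (sh : ShellSplit₁₃CoPH 2 K₀)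
  (rr : (F : T4Family) → (θ : Stage13HParams F 2) → θ.Provisos₁₃CoPH F 2 → (ℕ → ℝ) → List (ULoop F) → RateCarriers 2)
  (P : ∀ {F : T4Family}, Datum F 2 → RateCarriers 2 → Prop)

/-- ★★ (v1.0 reading `crOfRecord₁₃At`, `vol := 1` — SUPERSEDED AS THE K3⁷ v3 POINTER by the V-edition twin below (ref-O g3 READ-70 NIT); kept, landed decls are immutable.)
**K3⁷ FROM THE KEYED FACES AT THE READING OF RECORD, THE N21 FACE FROM THE DILATION ROAD** (`N = 2`): leaf E p585601
`spineGivenEndpointR13SepCoPH_of_keyedFacesP_dilationLevels` AT `cr := crOfRecord₁₃At K₀ jcut sh`, with the dilation package at the reading's carriers and NO domination ∕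
summability clause on the weight slot (§2).  N20, the rates at `P`, the N19′ edge and the extraction clause stay displayed AT THE READING (dag-n20-d's §5 ∕ §6 and dag-n20-w1's
sockets turn them into term-level statements; not consumed here).  NOT a discharge. [bookkeeping] -/
theorem spineGivenEndpointR13SepCoPH_crOfRecord₁₃At_of_keyedFacesP_dilationLevels
    (h20 : ∀ (F : T4Family) (θ : Stage13HParams F 2) (hP : θ.Provisos₁₃CoPH F 2), (θ.ZhUnity F 2 ∧ θ.SlotsNondegenerate₁₃ F 2) → θ.Admissible F 2 → ∀ (g₀ : ℕ → ℝ) (os : List (ULoop F)),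
      letI S := crOfRecord₁₃At K₀ jcut sh F θ hP g₀ os
      RelWeightBound S.l₀ S.T S.A S.B S.Bad S.W)
    (h21dil : ∀ (F : T4Family) (θ : Stage13HParams F 2) (hP : θ.Provisos₁₃CoPH F 2), (θ.ZhUnity F 2 ∧ θ.SlotsNondegenerate₁₃ F 2) → θ.Admissible F 2 →
      ∀ (g₀ : ℕ → ℝ) (os : List (ULoop F)),
      ∃ (σA σB : Type) (SA : ℕ → Finset σA) (SB : ℕ → Finset σB) (pieceA : ℕ → ℝ → σA → (Σ K, SiteSeqKey F (K₀ + K)) → ℝ)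
        (pieceB : ℕ → ℝ → σB → (Σ K, SiteSeqKey F (K₀ + K)) → ℝ) (lvlA : ℕ → σA → ℕ) (lvlB : ℕ → σB → ℕ) (MA dA ρA MB dB ρB : ℕ → ℝ)
        (N₁ : ℕ) (νbar Mbar d₀ c₁ ϑ : ℝ) (p q : ℕ),
        LevelLedger 1 (classSet₁₃ θ K₀ g₀) (weightA₁₃ θ hP K₀ g₀ os) (sh F θ hP g₀ os).1 SA pieceA lvlA (fun j => MA j * (3 * (dA j + 1) / (1 - ρA j))) ρA ∧
        LevelLedger 1 (classSet₁₃ θ K₀ g₀) (weightB₁₃ θ hP K₀ g₀ os) (sh F θ hP g₀ os).2 SB pieceB lvlB (fun j => MB j * (3 * (dB j + 1) / (1 - ρB j))) ρB ∧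
        LiveWindow SA lvlA N₁ νbar ∧ LiveWindow SB lvlB N₁ νbar ∧ 0 ≤ ϑ ∧ ϑ < 1 ∧
        (∀ j, 0 ≤ MA j) ∧ (∀ j, MA j ≤ Mbar * ((j : ℝ) ^ q + 1)) ∧ (∀ j, 0 ≤ MB j) ∧ (∀ j, MB j ≤ Mbar * ((j : ℝ) ^ q + 1)) ∧
        (∀ j, 0 ≤ dA j) ∧ (∀ j, dA j ≤ d₀ * ((j : ℝ) ^ p + 1)) ∧ (∀ j, 0 ≤ dB j) ∧ (∀ j, dB j ≤ d₀ * ((j : ℝ) ^ p + 1)) ∧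
        (∀ j, ρA j ≤ 1 / 2) ∧ (∀ j, ρA j ≤ c₁ * ϑ ^ j) ∧ (∀ j, ρB j ≤ 1 / 2) ∧ (∀ j, ρB j ≤ c₁ * ϑ ^ j))
    (hrates : ∀ (F : T4Family) (θ : Stage13HParams F 2) (hP : θ.Provisos₁₃CoPH F 2), (θ.ZhUnity F 2 ∧ θ.SlotsNondegenerate₁₃ F 2) → θ.Admissible F 2 → ∀ (g₀ : ℕ → ℝ) (os : List (ULoop F)),
      P (datumOfRecord₁₃CoPH F 2 θ hP) (rr F θ hP g₀ os))
    (h19 : ∀ (F : T4Family) (θ : Stage13HParams F 2) (hP : θ.Provisos₁₃CoPH F 2), (θ.ZhUnity F 2 ∧ θ.SlotsNondegenerate₁₃ F 2) → θ.Admissible F 2 → ∀ (g₀ : ℕ → ℝ) (os : List (ULoop F)),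
      P (datumOfRecord₁₃CoPH F 2 θ hP) (rr F θ hP g₀ os) → letI S := crOfRecord₁₃At K₀ jcut sh F θ hP g₀ os
        letI := S.dec
        ∃ δ : ℕ → ℝ, NE7.Core S.l₀ S.vol S.T S.Bad (fun K t τ => S.A K t τ - S.shA K t τ) (fun K t τ => S.B K t τ - S.shB K t τ) δ ∧ Summable δ)
    (hx : ∀ (F : T4Family) (θ : Stage13HParams F 2) (hP : θ.Provisos₁₃CoPH F 2), (θ.ZhUnity F 2 ∧ θ.SlotsNondegenerate₁₃ F 2) → θ.Admissible F 2 →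
      B16.EndStatementBPrinted (datumOfRecord₁₃CoPH F 2 θ hP).C → DagBinding.EndpointExistence (datumOfRecord₁₃CoPH F 2 θ hP).C.toB12 →
        ForSmallCouplings (datumOfRecord₁₃CoPH F 2 θ hP) fun g₀ => ∀ os : List (ULoop F), letI S := crOfRecord₁₃At K₀ jcut sh F θ hP g₀ os
          0 < S.l₀ ∧ 0 < S.vol ∧
          (∀ (K : ℕ) (t : ℝ), |t| ≤ S.l₀ →
            T4GenFunBounds.schemeZ ((datumOfRecord₁₃CoPH F 2 θ hP).scheme g₀) os (S.K₀ + K) t = ∑ τ ∈ S.T K, S.A K t τ) ∧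
          (∀ (K : ℕ) (t : ℝ), |t| ≤ S.l₀ →
            T4GenFunBounds.schemeZ ((datumOfRecord₁₃CoPH F 2 θ hP).scheme g₀) os (S.K₀ + K + 1) t = ∑ τ ∈ S.T K, S.B K t τ)) :
    SpineGivenEndpointR13SepCoPH :=
  fun F θ hP hG hθ _ _ => keyedGuarded₁₃CoPH_of_keyedFacesP (crOfRecord₁₃At K₀ jcut sh) rr (fun θ => θ.ZhUnity _ 2 ∧ θ.SlotsNondegenerate₁₃ _ 2) P
    h20 (shellWeightBound_guarded_crOfRecord₁₃At_of_dilationLevels K₀ jcut sh (fun F θ => θ.ZhUnity F 2 ∧ θ.SlotsNondegenerate₁₃ F 2) h21dil)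
    hrates h19 hx F θ hP.toCore hG hθ

/-- ★★ (v1.1) **K3⁷ FROM THE KEYED FACES AT THE V-EDITION READING OF RECORD `crOfRecord₁₃VAt` (`vol := F.side ^ 4`), THE N21 FACE FROM THE DILATION ROAD** (`N = 2`): leaf E p585601
`spineGivenEndpointR13SepCoPH_of_keyedFacesP_dilationLevels` AT `cr := crOfRecord₁₃VAt K₀ jcut sh`, with the dilation package at the reading's carriers and NO domination ∕
summability clause on the weight slot (§2).  N20, the rates at `P`, the N19′ edge and the extraction clause stay displayed AT THE READING (dag-n20-d's §5 ∕ §6 and dag-n20-w1's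
sockets turn them into term-level statements; not consumed here).  NOT a discharge. [bookkeeping] -/
theorem spineGivenEndpointR13SepCoPH_crOfRecord₁₃VAt_of_keyedFacesP_dilationLevels
    (h20 : ∀ (F : T4Family) (θ : Stage13HParams F 2) (hP : θ.Provisos₁₃CoPH F 2), (θ.ZhUnity F 2 ∧ θ.SlotsNondegenerate₁₃ F 2) → θ.Admissible F 2 → ∀ (g₀ : ℕ → ℝ) (os : List (ULoop F)),
      letI S := crOfRecord₁₃VAt K₀ jcut sh F θ hP g₀ os
      RelWeightBound S.l₀ S.T S.A S.B S.Bad S.W)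
    (h21dil : ∀ (F : T4Family) (θ : Stage13HParams F 2) (hP : θ.Provisos₁₃CoPH F 2), (θ.ZhUnity F 2 ∧ θ.SlotsNondegenerate₁₃ F 2) → θ.Admissible F 2 →
      ∀ (g₀ : ℕ → ℝ) (os : List (ULoop F)),
      ∃ (σA σB : Type) (SA : ℕ → Finset σA) (SB : ℕ → Finset σB) (pieceA : ℕ → ℝ → σA → (Σ K, SiteSeqKey F (K₀ + K)) → ℝ)
        (pieceB : ℕ → ℝ → σB → (Σ K, SiteSeqKey F (K₀ + K)) → ℝ) (lvlA : ℕ → σA → ℕ) (lvlB : ℕ → σB → ℕ) (MA dA ρA MB dB ρB : ℕ → ℝ)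
        (N₁ : ℕ) (νbar Mbar d₀ c₁ ϑ : ℝ) (p q : ℕ),
        LevelLedger 1 (classSet₁₃ θ K₀ g₀) (weightA₁₃ θ hP K₀ g₀ os) (sh F θ hP g₀ os).1 SA pieceA lvlA (fun j => MA j * (3 * (dA j + 1) / (1 - ρA j))) ρA ∧
        LevelLedger 1 (classSet₁₃ θ K₀ g₀) (weightB₁₃ θ hP K₀ g₀ os) (sh F θ hP g₀ os).2 SB pieceB lvlB (fun j => MB j * (3 * (dB j + 1) / (1 - ρB j))) ρB ∧
        LiveWindow SA lvlA N₁ νbar ∧ LiveWindow SB lvlB N₁ νbar ∧ 0 ≤ ϑ ∧ ϑ < 1 ∧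
        (∀ j, 0 ≤ MA j) ∧ (∀ j, MA j ≤ Mbar * ((j : ℝ) ^ q + 1)) ∧ (∀ j, 0 ≤ MB j) ∧ (∀ j, MB j ≤ Mbar * ((j : ℝ) ^ q + 1)) ∧
        (∀ j, 0 ≤ dA j) ∧ (∀ j, dA j ≤ d₀ * ((j : ℝ) ^ p + 1)) ∧ (∀ j, 0 ≤ dB j) ∧ (∀ j, dB j ≤ d₀ * ((j : ℝ) ^ p + 1)) ∧
        (∀ j, ρA j ≤ 1 / 2) ∧ (∀ j, ρA j ≤ c₁ * ϑ ^ j) ∧ (∀ j, ρB j ≤ 1 / 2) ∧ (∀ j, ρB j ≤ c₁ * ϑ ^ j))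
    (hrates : ∀ (F : T4Family) (θ : Stage13HParams F 2) (hP : θ.Provisos₁₃CoPH F 2), (θ.ZhUnity F 2 ∧ θ.SlotsNondegenerate₁₃ F 2) → θ.Admissible F 2 → ∀ (g₀ : ℕ → ℝ) (os : List (ULoop F)),
      P (datumOfRecord₁₃CoPH F 2 θ hP) (rr F θ hP g₀ os))
    (h19 : ∀ (F : T4Family) (θ : Stage13HParams F 2) (hP : θ.Provisos₁₃CoPH F 2), (θ.ZhUnity F 2 ∧ θ.SlotsNondegenerate₁₃ F 2) → θ.Admissible F 2 → ∀ (g₀ : ℕ → ℝ) (os : List (ULoop F)),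
      P (datumOfRecord₁₃CoPH F 2 θ hP) (rr F θ hP g₀ os) → letI S := crOfRecord₁₃VAt K₀ jcut sh F θ hP g₀ os
        letI := S.dec
        ∃ δ : ℕ → ℝ, NE7.Core S.l₀ S.vol S.T S.Bad (fun K t τ => S.A K t τ - S.shA K t τ) (fun K t τ => S.B K t τ - S.shB K t τ) δ ∧ Summable δ)
    (hx : ∀ (F : T4Family) (θ : Stage13HParams F 2) (hP : θ.Provisos₁₃CoPH F 2), (θ.ZhUnity F 2 ∧ θ.SlotsNondegenerate₁₃ F 2) → θ.Admissible F 2 →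
      B16.EndStatementBPrinted (datumOfRecord₁₃CoPH F 2 θ hP).C → DagBinding.EndpointExistence (datumOfRecord₁₃CoPH F 2 θ hP).C.toB12 →
        ForSmallCouplings (datumOfRecord₁₃CoPH F 2 θ hP) fun g₀ => ∀ os : List (ULoop F), letI S := crOfRecord₁₃VAt K₀ jcut sh F θ hP g₀ os
          0 < S.l₀ ∧ 0 < S.vol ∧
          (∀ (K : ℕ) (t : ℝ), |t| ≤ S.l₀ →
            T4GenFunBounds.schemeZ ((datumOfRecord₁₃CoPH F 2 θ hP).scheme g₀) os (S.K₀ + K) t = ∑ τ ∈ S.T K, S.A K t τ) ∧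
          (∀ (K : ℕ) (t : ℝ), |t| ≤ S.l₀ →
            T4GenFunBounds.schemeZ ((datumOfRecord₁₃CoPH F 2 θ hP).scheme g₀) os (S.K₀ + K + 1) t = ∑ τ ∈ S.T K, S.B K t τ)) :
    SpineGivenEndpointR13SepCoPH :=
  fun F θ hP hG hθ _ _ => keyedGuarded₁₃CoPH_of_keyedFacesP (crOfRecord₁₃VAt K₀ jcut sh) rr (fun θ => θ.ZhUnity _ 2 ∧ θ.SlotsNondegenerate₁₃ _ 2) P
    h20 (shellWeightBound_guarded_crOfRecord₁₃VAt_of_dilationLevels K₀ jcut sh (fun F θ => θ.ZhUnity F 2 ∧ θ.SlotsNondegenerate₁₃ F 2) h21dil)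
    hrates h19 hx F θ hP.toCore hG hθ

end LeafF

end Summit.QuantumFields.YangMills.Theorems.N21DilationRoadAtRecord13CoPH
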